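import Summits.MatrixMultiplication.MatrixMultiplication.Theorems.SoloInformedThirdRow

/-!
# THEOREM 8.20, Steps 0–1: common cells of poor rows, and the data of an X-pair

This work, §8.8 (T12)(f) Steps 1–2 and C3-m2 §5.5 (gen 107). Setting as in `SoloInformedThirdRow`.

* `exists_common_cell` (STEP 0): two rows with at most `C` values each are constant together on a common cell of
  size `≥ n / C²` (pigeonhole on value pairs) — the common cells `K*(j,j′)` of the poor family.
* `Data.xpair_data` (STEP 1 ⟹ STEP 2 entry): a pair typed X by `Data.pair_typed` (`a(·,j) ∼ w`, `a(·,j′) ∼ w″` off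
  `< t` rows, `w″ ≁ w`) satisfies `n·t′·(n − t) ≤ r·|S⁰|` or carries the full X-PAIR DATA consumed by
  `Data.third_row_kind` / `Data.family_kinds`: exception sets `E` (`≤ t` rows), `F` (`≤ t′` columns) off which
  `a(·,j) ∼ w`, `a(·,j′) ∼ w″`, `b(j,·) ∼ w″`, `b(j′,·) ∼ w` [the 8.16′ move `Data.cols_move`].
With `SoloInformedThirdRow`, `SoloInformedFamilyKinds` and `SoloInformedNearRectLines` this makes Steps 0–2 of
THEOREM 8.20 kernel statements end to end (the remaining text is arithmetic on the explicit bounds).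
-/

namespace Summit.MatrixMultiplication.MatrixMultiplication.Theorems.TwistedTPP

namespace FibreLines

variable {ι G : Type*} [AddCommGroup G]

/-- **STEP 0 (common cells).** Two functions with at most `C` values each are constant together on a set of size
`≥ n / C²`. [this work, §8.8 (T12)(f) Step 1; C3-m2 §5.2] -/
theorem exists_common_cell [Fintype ι] [DecidableEq ι] [DecidableEq G] (f g : ι → G) (C : ℕ)
    (hf : (Finset.univ.image f).card ≤ C) (hg : (Finset.univ.image g).card ≤ C) :
    ∃ Ks : Finset ι, ∃ w w' : G, Fintype.card ι / (C * C) ≤ Ks.card ∧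
      (∀ k ∈ Ks, f k = w) ∧ ∀ k ∈ Ks, g k = w' := by
  classical
  rcases isEmpty_or_nonempty ι with hι | ⟨⟨k₀⟩⟩
  · exact ⟨∅, 0, 0, by simp, by simp, by simp⟩
  set T : Finset (G × G) := (Finset.univ.image f) ×ˢ (Finset.univ.image g) with hT
  have hTc : T.card ≤ C * C := by
    rw [Finset.card_product]; exact Nat.mul_le_mul hf hg
  have hmaps : ∀ k ∈ (Finset.univ : Finset ι), (f k, g k) ∈ T := fun k _ =>
    Finset.mem_product.2 ⟨Finset.mem_image_of_mem _ (Finset.mem_univ _),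
      Finset.mem_image_of_mem _ (Finset.mem_univ _)⟩
  have hne : T.Nonempty := ⟨(f k₀, g k₀), hmaps k₀ (Finset.mem_univ _)⟩
  have hn : T.card * (Fintype.card ι / (C * C)) ≤ (Finset.univ : Finset ι).card := by
    rw [Finset.card_univ]
    exact (Nat.mul_le_mul_right _ hTc).trans (Nat.mul_div_le _ _)
  obtain ⟨y, -, hcard⟩ := Finset.exists_le_card_fiber_of_mul_le_card_of_maps_to hmaps hne hn
  refine ⟨Finset.univ.filter (fun k => (f k, g k) = y), y.1, y.2, hcard, fun k hk => ?_, fun k hk => ?_⟩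
  · exact congrArg Prod.fst (Finset.mem_filter.1 hk).2
  · exact congrArg Prod.snd (Finset.mem_filter.1 hk).2

variable {G₀ : Type*} [AddCommGroup G₀] {R : Type*}

/-- **THE DATA OF AN X-PAIR.** [this work, §8.8 (T12)(f) Step 2; C3-m2 §5.5] -/
theorem Data.xpair_data [Fintype ι] [DecidableEq ι] [Fintype G₀] [DecidableEq G₀] [Fintype R]
    [DecidableEq R] (hG : ∀ x : G, x = -x → x = 0) (D : Data ι G) (Φ : Chart ι G₀) (κ : G → R)
    (hκ : ∀ x y, κ x = κ y → SignEq x y) (hsep : D.SepAll Φ) {j j' : ι} {w'' w : G}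
    (hX : ¬ SignEq w'' w) (Ig : Finset ι) (t t' : ℕ) (hIg : Fintype.card ι < Ig.card + t)
    (ha : ∀ i ∈ Ig, SignEq (D.a i j) w ∧ SignEq (D.a i j') w'') :
    Fintype.card ι * t' * (Fintype.card ι - t) ≤ Fintype.card R * Fintype.card G₀ ∨
      ∃ E F : Finset ι, E.card ≤ t ∧ F.card ≤ t' ∧ (∀ i, i ∉ E → SignEq (D.a i j) w) ∧
        (∀ i, i ∉ E → SignEq (D.a i j') w'') ∧ (∀ k, k ∉ F → SignEq (D.b j k) w'') ∧
        ∀ k, k ∉ F → SignEq (D.b j' k) w := by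
  classical
  rcases D.cols_move hG Φ κ hκ hsep (fun h => hX h.symm) Ig (fun i hi => (ha i hi).1)
    (fun i hi => (ha i hi).2) t' with hb | ⟨Kg, hKg, hk⟩
  · left
    refine le_trans (Nat.mul_le_mul_left _ ?_) hb
    omega
  · right
    have hI : ∀ i, i ∉ Igᶜ → i ∈ Ig := fun i hi => by
      by_contra hc; exact hi (Finset.mem_compl.2 hc)
    have hK : ∀ k, k ∉ Kgᶜ → k ∈ Kg := fun k hk' => by
      by_contra hc; exact hk' (Finset.mem_compl.2 hc)
    refine ⟨Igᶜ, Kgᶜ, by rw [Finset.card_compl]; omega, by rw [Finset.card_compl]; omega,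
      fun i hi => (ha i (hI i hi)).1, fun i hi => (ha i (hI i hi)).2,
      fun k hk' => (hk k (hK k hk')).2, fun k hk' => (hk k (hK k hk')).1⟩

end FibreLines

end Summit.MatrixMultiplication.MatrixMultiplication.Theorems.TwistedTPP
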